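import Summits.QuantumFields.YangMills.Theorems.PoincareLipschitzHierAlignT3Sharp
import Summits.QuantumFields.YangMills.Theorems.PoincareLipschitzHierAlignPertVar
import HarnessLib

/-!
# Crux stmt-QuantumFields-19936 `HistoryTailL` — S-ALIGN (S2) SIMULT: ONE FINE GAUGE ALIGNS THE WHOLE TOWER WITH GEOMETRIC DECAY
# `dist1 ((Ū^i (U^u)) c) ≤ 72L²·Σ_{i≤i'<j+1} θBal(K−i')(2∕L)^{i'−i} + 3347L³·θBal(K−j)(2∕L)^{j+1−i}` at every height `i ≤ j`, same fine `u`

Cell `ym3-torus` (rung R3 = YM₃ on T³ — a RUNG, NOT the Clay problem), width seat `ym-ust-19936-w3` gen 12, `--supports stmt-QuantumFields-19936 --as helper`.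
Summons w2 g11 02:42:44Z «w3 g12: S-ALIGN … plus two-field ∕ SIMULT ∕ pertVar twins as in p688052 ∕ p688433».  The SIMULT twin of
✓`PoincareLipschitzHierAlignT3Sharp`, by the pattern of ✓`PoincareLipschitzHierAlignT3Simult`: the sharp steps are ROOTED
(✓`…T3Sharp.exists_rooted_sharp_step`: `u_i ∘ emb = u_{i+1}`), so the gauges of all heights are the block-centre restrictions `transfUp u i` of ONE fine
gauge `u = u_0`, and `Ū^i(U^u) = (Ū^i U)^{transfUp u i}` (✓`iter_gaugeAct`).  THIS FILE: `exists_sharp_family_of_windows` (the rooted family, flat at the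
two top levels ✓T3Simult, sharp below), ★★★ `exists_fineGauge_iter_dist1_le_of_windows_sharp`, ★★ `exists_relGauge_iter_dist1_le_of_windows_sharp`
(two fields, one relative fine gauge, `2×` the bound) and the `pertVar` twins `exists_relGauge_norm_pertVar_iter_le_of_windows_sharp`,
`exists_relGauge_norm_pertVar_iter_gaugeAct_le_of_windows_sharp` (✓`PoincareLipschitzHierAlignPertVar` letters).  Hypotheses: hStab's windows VERBATIM, `θBal(K−i) ≤ 1∕(2·10⁷L⁴)` (`i ≤ j`), `0 ≤ p₀`, `j + 3 ≤ K`;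
regions `5L^{j+1} + 12(L^i − 1)`.  Def-free.
-/

noncomputable section

open scoped BigOperators Matrix.Norms.L2Operator

namespace Summit.QuantumFields.YangMills.Theorems.PoincareLipschitzHierAlignT3SharpSimult

open Literature.MathematicalPhysics.QuantumFieldTheory.Balaban1983to89
open Literature.MathematicalPhysics.QuantumFieldTheory.Balaban1983to89.T3ContinuumYM3Torus
open Literature.MathematicalPhysics.QuantumFieldTheory.Balaban1983to89.T3UnitLawDensityEML
open T4Continuum BlockAveraging ExpMeanLog T3UnitScaleTilt BlockAveragingEMLLinearisedBackground
open Summit.QuantumFields.YangMills.Theorems.PoincareLipschitzHierAlignTower (dist1_relGauge_le)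
open Summit.QuantumFields.YangMills.Theorems.PoincareLipschitzHierAlignT3Simult (exists_family_of_windows transfUp_inv_mul)
open Summit.QuantumFields.YangMills.Theorems.PoincareLipschitzHierAlignT3Sharp (exists_rooted_sharp_step)
open Summit.QuantumFields.YangMills.Theorems.PoincareLipschitzHierAlignPertVar (norm_pertVar_eq_dist1 dist1_gaugeAct_mul_inv_le
  dist1_gaugeAct_gaugeAct_mul_inv_le)

variable {F : T3Family} {K j : ℕ} {γ b₀ p₀ : ℝ}

/-- ★ **THE ROOTED SHARP FAMILY**: gauges `w i'` of every height `i ≤ i' ≤ j + 1` with `w i' ∘ emb = w (i'+1)` (`i' ≤ j`), the sharp charts at the heights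
`≤ j` and the flat top chart at `j + 1` (✓T3Simult's family for the two top levels, ✓`exists_rooted_sharp_step` below). [folklore] -/
theorem exists_sharp_family_of_windows (hjK : j + 3 ≤ K) (hγ : 0 < γ) (hγ1 : γ ≤ 1) (hb : 0 < b₀) (hp : 0 ≤ p₀)
    (hθσ : ∀ i, i ≤ j → θBal F.L γ b₀ p₀ (K - i) ≤ 1 / (2 * 10 ^ 7 * (F.L : ℝ) ^ 4))
    (a : Plaq (F.P K) (j + 1)) (U : GaugeField (F.P K) 0 (Matrix.specialUnitaryGroup (Fin 2) ℂ))
    (hU : (∀ (i : ℕ) (q : Plaq (F.P K) i), i < j + 1 → Site.tdist (fun k => ((((q.src k).val * F.L ^ i : ℕ)) : ZMod ((F.P K).sitesPerDir 0))) (fun k => ((((a.src k).val * F.L ^ (j + 1) : ℕ)) : ZMod ((F.P K).sitesPerDir 0))) + 64 * F.L ^ i ≤ 64 * F.L ^ (j + 1) → GaugeGroup.dist1 (GaugeField.plaqHol (Averaging.iter (fun i' => BlockAveraging.blockAvg (P := F.P K) (j := i') T3UnitLawDensityEML.ℰp) i U) q) < T3UnitScaleTilt.θBal F.L γ b₀ p₀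 (K - i))) :
    ∀ (N i : ℕ), i + N = j →
      ∃ w : (i' : ℕ) → GaugeTransf (F.P K) i' (Matrix.specialUnitaryGroup (Fin 2) ℂ),
        (∀ i', i ≤ i' → i' ≤ j → ∀ y : Site (F.P K) (i' + 1), w i' (emb y) = w (i' + 1) y) ∧
        (∀ i', i ≤ i' → i' ≤ j → ∀ c : PBond (F.P K) i',
          Site.tdist (fun k => ((((c.src k).val * F.L ^ i' : ℕ)) : ZMod ((F.P K).sitesPerDir 0)))
          (fun k => ((((a.src k).val * F.L ^ (j + 1) : ℕ)) : ZMod ((F.P K).sitesPerDir 0))) ≤ 5 * F.L ^ (j + 1) + 12 * (F.L ^ i' - 1) →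
          dist1 (GaugeField.gaugeAct (w i') (Averaging.iter (fun i'' => BlockAveraging.blockAvg (P := F.P K) (j := i'') T3UnitLawDensityEML.ℰp) i' U) c) ≤
            72 * (F.L : ℝ) ^ 2 * (∑ i'' ∈ Finset.Ico i' j, θBal F.L γ b₀ p₀ (K - i'') * ((2 : ℝ) / F.L) ^ (i'' - i')) +
            6694 * (F.L : ℝ) ^ 2 * θBal F.L γ b₀ p₀ (K - j) * ((2 : ℝ) / F.L) ^ (j - i')) ∧
        (∀ c : PBond (F.P K) (j + 1),
          Site.tdist (fun k => ((((c.src k).val * F.L ^ (j + 1) : ℕ)) : ZMod ((F.P K).sitesPerDir 0)))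
              (fun k => ((((a.src k).val * F.L ^ (j + 1) : ℕ)) : ZMod ((F.P K).sitesPerDir 0))) ≤ 8 * F.L ^ (j + 1) + 3 * (F.L ^ (j + 1) - 1) →
          dist1 (GaugeField.gaugeAct (w (j + 1)) (Averaging.iter (fun i'' => BlockAveraging.blockAvg (P := F.P K) (j := i'') T3UnitLawDensityEML.ℰp) (j + 1) U) c) ≤
            50 * (F.L : ℝ) ^ 2 * (∑ i'' ∈ Finset.Ico (j + 1) (j + 1), θBal F.L γ b₀ p₀ (K - i'')) + 6644 * (F.L : ℝ) ^ 2 * θBal F.L γ b₀ p₀ (K - j)) := by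
  have hL3 : 3 ≤ F.L := (by obtain ⟨k, hk⟩ := F.hL.1; have := F.hL.2; omega)
  have hLr : (3 : ℝ) ≤ F.L := by exact_mod_cast hL3
  have hm := F.hm
  have hθ0 : ∀ i, 0 ≤ θBal F.L γ b₀ p₀ (K - i) := fun i =>
    (T3MinimiserStabilityReduction.θBal_pos (by omega) hγ hγ1 hb p₀ (K - i)).le
  have hσ75 : ∀ i, i ≤ j → θBal F.L γ b₀ p₀ (K - i) ≤ 1 / (75 * ((F.L : ℝ) + 1) ^ 2) := fun i hi => (hθσ i hi).trans (by
    rw [div_le_div_iff₀ (by positivity) (by positivity), one_mul, one_mul]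
    have hL2 : (9 : ℝ) ≤ (F.L : ℝ) ^ 2 := by nlinarith
    have h1 : ((F.L : ℝ) + 1) ^ 2 ≤ 4 * (F.L : ℝ) ^ 2 := by nlinarith
    have h4 : (F.L : ℝ) ^ 4 = (F.L : ℝ) ^ 2 * (F.L : ℝ) ^ 2 := by ring
    nlinarith)
  intro N
  induction N with
  | zero =>
    intro i hi
    rw [Nat.add_zero] at hi
    subst hi
    -- the flat family on the two top levels
    obtain ⟨w, hroot, hchart⟩ := exists_family_of_windows hjK hγ hγ1 hb hσ75 a U hU 1 i (by omega)
    refine ⟨w, fun i' h1 h2 y => hroot i' h1 h2 y, fun i' h1 h2 c hc => ?_, fun c hc => hchart (i + 1) (by omega) le_rfl c hc⟩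
    obtain rfl : i' = i := le_antisymm h2 h1
    have hreg : 5 * F.L ^ (i' + 1) + 12 * (F.L ^ i' - 1) ≤ 8 * F.L ^ (i' + 1) + 3 * (F.L ^ i' - 1) := by
      have : 9 * F.L ^ i' ≤ 3 * F.L ^ (i' + 1) := by
        rw [pow_succ]
        calc 9 * F.L ^ i' = 3 * (F.L ^ i' * 3) := by ring
          _ ≤ 3 * (F.L ^ i' * F.L) := Nat.mul_le_mul_left _ (Nat.mul_le_mul_left _ hL3)
      omega
    have h1' := hchart i' le_rfl (by omega) c (hc.trans hreg)
    rw [Finset.sum_Ico_succ_top (by omega : i' ≤ i'), Finset.Ico_self, Finset.sum_empty, zero_add] at h1'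
    rw [Finset.Ico_self, Finset.sum_empty, mul_zero, zero_add, Nat.sub_self, pow_zero, mul_one]
    linarith
  | succ N ih =>
    intro i hi
    have hij : i < j := by omega
    obtain ⟨w, hroot, hchart, htop⟩ := ih (i + 1) (by omega)
    obtain ⟨u, huroot, hstep⟩ := exists_rooted_sharp_step hjK hγ hγ1 hb hp hθσ a U hU hij (w (i + 1))
      (fun c hc => hchart (i + 1) le_rfl (by omega) c hc)
    refine ⟨fun i' => if h : i' = i then h ▸ u else w i', fun i' h1 h2 y => ?_, fun i' h1 h2 c hc => ?_, fun c hc => ?_⟩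
    · -- root letters
      by_cases hi' : i' = i
      · subst hi'
        have hne : i' + 1 ≠ i' := by omega
        simp only [dif_pos, hne, dif_neg, not_false_eq_true]
        exact huroot y
      · have hne : i' + 1 ≠ i := by omega
        simp only [hi', hne, dif_neg, not_false_eq_true]
        exact hroot i' (by omega) h2 y
    · -- charts
      by_cases hi' : i' = i
      · subst hi'
        simp only [dif_pos]
        exact hstep c hc
      · simp only [hi', dif_neg, not_false_eq_true]
        exact hchart i' (by omega) h2 c hc
    · -- the top chart
      have hne : j + 1 ≠ i := by omega
      simp only [hne, dif_neg, not_false_eq_true]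
      exact htop c hc

/-- ★★★ **ONE FINE GAUGE ALIGNS THE WHOLE TOWER, WITH GEOMETRIC DECAY**: under hStab's windows around `a` (`j + 3 ≤ K`, `0 < γ ≤ 1`, `0 < b₀`,
`0 ≤ p₀`, `θBal(K−i) ≤ 1∕(2·10⁷L⁴)` for `i ≤ j`), ONE gauge `u` of the finest torus gives, at EVERY height `i ≤ j` and every level-`i` bond `c` with
scaled corner within `5L^{j+1} + 12(L^i − 1)` of `a₋·L^{j+1}`,
`dist1 ((Ū^i (U^u)) c) ≤ 72L²·Σ_{i≤i'<j+1} θBal(K−i')(2∕L)^{i'−i} + 3347L³·θBal(K−j)(2∕L)^{j+1−i}`. [folklore] -/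
theorem exists_fineGauge_iter_dist1_le_of_windows_sharp (hjK : j + 3 ≤ K) (hγ : 0 < γ) (hγ1 : γ ≤ 1) (hb : 0 < b₀) (hp : 0 ≤ p₀)
    (hθσ : ∀ i, i ≤ j → θBal F.L γ b₀ p₀ (K - i) ≤ 1 / (2 * 10 ^ 7 * (F.L : ℝ) ^ 4))
    (a : Plaq (F.P K) (j + 1)) (U : GaugeField (F.P K) 0 (Matrix.specialUnitaryGroup (Fin 2) ℂ))
    (hU : (∀ (i : ℕ) (q : Plaq (F.P K) i), i < j + 1 → Site.tdist (fun k => ((((q.src k).val * F.L ^ i : ℕ)) : ZMod ((F.P K).sitesPerDir 0))) (fun k => ((((a.src k).val * F.L ^ (j + 1) : ℕ)) : ZMod ((F.P K).sitesPerDir 0))) + 64 * F.L ^ i ≤ 64 * F.L ^ (j + 1) → GaugeGroup.dist1 (GaugeField.plaqHol (Averaging.iter (fun i' => BlockAveraging.blockAvg (P := F.P K) (j := i') T3UnitLawDensityEML.ℰp) i U) q) < T3UnitScaleTilt.θBal F.L γ b₀ p₀ (K - i))) :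
    ∃ u : GaugeTransf (F.P K) 0 (Matrix.specialUnitaryGroup (Fin 2) ℂ), ∀ (i : ℕ), i ≤ j → ∀ c : PBond (F.P K) i,
      Site.tdist (fun k => ((((c.src k).val * F.L ^ i : ℕ)) : ZMod ((F.P K).sitesPerDir 0)))
          (fun k => ((((a.src k).val * F.L ^ (j + 1) : ℕ)) : ZMod ((F.P K).sitesPerDir 0))) ≤ 5 * F.L ^ (j + 1) + 12 * (F.L ^ i - 1) →
      dist1 ((Averaging.iter (fun i'' => BlockAveraging.blockAvg (P := F.P K) (j := i'') T3UnitLawDensityEML.ℰp) i (GaugeField.gaugeAct u U)) c) ≤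
        72 * (F.L : ℝ) ^ 2 * (∑ i'' ∈ Finset.Ico i (j + 1), θBal F.L γ b₀ p₀ (K - i'') * ((2 : ℝ) / F.L) ^ (i'' - i)) +
          3347 * (F.L : ℝ) ^ 3 * θBal F.L γ b₀ p₀ (K - j) * ((2 : ℝ) / F.L) ^ (j + 1 - i) := by
  have hL3 : 3 ≤ F.L := (by obtain ⟨k, hk⟩ := F.hL.1; have := F.hL.2; omega)
  have hLr : (3 : ℝ) ≤ F.L := by exact_mod_cast hL3
  have hL0 : (0 : ℝ) < F.L := by linarith
  have hm := F.hm
  have hθ0 : ∀ i, 0 ≤ θBal F.L γ b₀ p₀ (K - i) := fun i =>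
    (T3MinimiserStabilityReduction.θBal_pos (by omega) hγ hγ1 hb p₀ (K - i)).le
  have hr0 : (0 : ℝ) ≤ 2 / F.L := by positivity
  obtain ⟨w, hroot, hchart, -⟩ := exists_sharp_family_of_windows hjK hγ hγ1 hb hp hθσ a U hU j 0 (by omega)
  refine ⟨w 0, fun i hi c hc => ?_⟩
  have hup : ∀ i', i' ≤ j + 1 → transfUp (w 0) i' = w i' := by
    intro i'
    induction i' with
    | zero => intro; rfl
    | succ i' ih =>
      intro hi'
      funext y
      show transfUp (w 0) i' (emb y) = w (i' + 1) y
      rw [ih (by omega)]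
      exact hroot i' (Nat.zero_le _) (by omega) y
  have hiK : i ≤ (F.P K).m + (F.P K).K := by show i ≤ F.m + K; omega
  rw [iter_gaugeAct _ (w 0) i hiK U, hup i (by omega)]
  refine (hchart i (Nat.zero_le _) hi c hc).trans ?_
  rw [Finset.sum_Ico_succ_top (by omega : i ≤ j)]
  have hlast : 0 ≤ θBal F.L γ b₀ p₀ (K - j) * ((2 : ℝ) / F.L) ^ (j - i) := mul_nonneg (hθ0 j) (pow_nonneg hr0 _)
  have e : ((2 : ℝ) / F.L) ^ (j + 1 - i) = (2 / F.L) * ((2 : ℝ) / F.L) ^ (j - i) := by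
    have : j + 1 - i = (j - i) + 1 := by omega
    rw [this, pow_succ]; ring
  rw [e]
  have e2 : 3347 * (F.L : ℝ) ^ 3 * θBal F.L γ b₀ p₀ (K - j) * ((2 / F.L) * ((2 : ℝ) / F.L) ^ (j - i)) =
      6694 * (F.L : ℝ) ^ 2 * θBal F.L γ b₀ p₀ (K - j) * ((2 : ℝ) / F.L) ^ (j - i) := by
    field_simp; ring
  rw [e2]
  nlinarith [sq_nonneg (F.L : ℝ)]

/-- ★★ **THE TWO-FIELD FORM — ONE RELATIVE FINE GAUGE FOR THE WHOLE TOWER, WITH GEOMETRIC DECAY**: for two configurations `U, U'` with hStab's windows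
around `a`, ONE gauge `g` of the finest torus gives `dist1 ((Ū^i (U'^g)) c · ((Ū^i U) c)⁻¹) ≤ 2·(72L²·Σ_{i≤i'<j+1} θBal(K−i')(2∕L)^{i'−i} +
3347L³·θBal(K−j)(2∕L)^{j+1−i})` at EVERY height `i ≤ j` on the level-`i` regions. [folklore] -/
theorem exists_relGauge_iter_dist1_le_of_windows_sharp (hjK : j + 3 ≤ K) (hγ : 0 < γ) (hγ1 : γ ≤ 1) (hb : 0 < b₀) (hp : 0 ≤ p₀)
    (hθσ : ∀ i, i ≤ j → θBal F.L γ b₀ p₀ (K - i) ≤ 1 / (2 * 10 ^ 7 * (F.L : ℝ) ^ 4))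
    (a : Plaq (F.P K) (j + 1)) (U U' : GaugeField (F.P K) 0 (Matrix.specialUnitaryGroup (Fin 2) ℂ))
    (hU : (∀ (i : ℕ) (q : Plaq (F.P K) i), i < j + 1 → Site.tdist (fun k => ((((q.src k).val * F.L ^ i : ℕ)) : ZMod ((F.P K).sitesPerDir 0))) (fun k => ((((a.src k).val * F.L ^ (j + 1) : ℕ)) : ZMod ((F.P K).sitesPerDir 0))) + 64 * F.L ^ i ≤ 64 * F.L ^ (j + 1) → GaugeGroup.dist1 (GaugeField.plaqHol (Averaging.iter (fun i' => BlockAveraging.blockAvg (P := F.P K) (j := i') T3UnitLawDensityEML.ℰp) i U) q) < T3UnitScaleTilt.θBal F.L γ b₀ p₀ (K - i)))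
    (hU' : (∀ (i : ℕ) (q : Plaq (F.P K) i), i < j + 1 → Site.tdist (fun k => ((((q.src k).val * F.L ^ i : ℕ)) : ZMod ((F.P K).sitesPerDir 0))) (fun k => ((((a.src k).val * F.L ^ (j + 1) : ℕ)) : ZMod ((F.P K).sitesPerDir 0))) + 64 * F.L ^ i ≤ 64 * F.L ^ (j + 1) → GaugeGroup.dist1 (GaugeField.plaqHol (Averaging.iter (fun i' => BlockAveraging.blockAvg (P := F.P K) (j := i') T3UnitLawDensityEML.ℰp) i U') q) < T3UnitScaleTilt.θBal F.L γ b₀ p₀ (K - i))) :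
    ∃ g : GaugeTransf (F.P K) 0 (Matrix.specialUnitaryGroup (Fin 2) ℂ), ∀ (i : ℕ), i ≤ j → ∀ c : PBond (F.P K) i,
      Site.tdist (fun k => ((((c.src k).val * F.L ^ i : ℕ)) : ZMod ((F.P K).sitesPerDir 0)))
          (fun k => ((((a.src k).val * F.L ^ (j + 1) : ℕ)) : ZMod ((F.P K).sitesPerDir 0))) ≤ 5 * F.L ^ (j + 1) + 12 * (F.L ^ i - 1) →
      dist1 ((Averaging.iter (fun i'' => BlockAveraging.blockAvg (P := F.P K) (j := i'') T3UnitLawDensityEML.ℰp) i (GaugeField.gaugeAct g U')) c *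
          ((Averaging.iter (fun i'' => BlockAveraging.blockAvg (P := F.P K) (j := i'') T3UnitLawDensityEML.ℰp) i U) c)⁻¹) ≤
        2 * (72 * (F.L : ℝ) ^ 2 * (∑ i'' ∈ Finset.Ico i (j + 1), θBal F.L γ b₀ p₀ (K - i'') * ((2 : ℝ) / F.L) ^ (i'' - i)) +
          3347 * (F.L : ℝ) ^ 3 * θBal F.L γ b₀ p₀ (K - j) * ((2 : ℝ) / F.L) ^ (j + 1 - i)) := by
  have hm := F.hm
  obtain ⟨u, hu⟩ := exists_fineGauge_iter_dist1_le_of_windows_sharp hjK hγ hγ1 hb hp hθσ a U hU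
  obtain ⟨u', hu'⟩ := exists_fineGauge_iter_dist1_le_of_windows_sharp hjK hγ hγ1 hb hp hθσ a U' hU'
  refine ⟨fun x => (u x)⁻¹ * u' x, fun i hi c hc => ?_⟩
  have hiK : i ≤ (F.P K).m + (F.P K).K := by show i ≤ F.m + K; omega
  have h1 := hu i hi c hc
  have h2 := hu' i hi c hc
  rw [iter_gaugeAct _ u i hiK U] at h1
  rw [iter_gaugeAct _ u' i hiK U'] at h2
  rw [iter_gaugeAct _ _ i hiK U', transfUp_inv_mul u u' i]
  have h := dist1_relGauge_le _ _ (transfUp u i) (transfUp u' i) c h1 h2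
  linarith

/-- ★★ **THE `pertVar` READING WITH THE DRIFT SLOTS** (sharp twin of ✓`PoincareLipschitzHierAlignPertVar.exists_relGauge_norm_pertVar_iter_le_of_windows`):
ONE fine gauge `g` such that for every height `i ≤ j`, EVERY gauge `h` of `T^{(i)}` and every level-`i` bond `c` in the region,
`‖pertVar (Ū^i U) ((Ū^i (U'^g))^h) c‖ ≤ 2β_i + dist1 (h c₋) + dist1 (h c₊)`, `β_i` the sharp bound. [folklore] -/
theorem exists_relGauge_norm_pertVar_iter_le_of_windows_sharp (hjK : j + 3 ≤ K) (hγ : 0 < γ) (hγ1 : γ ≤ 1) (hb : 0 < b₀) (hp : 0 ≤ p₀)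
    (hθσ : ∀ i, i ≤ j → θBal F.L γ b₀ p₀ (K - i) ≤ 1 / (2 * 10 ^ 7 * (F.L : ℝ) ^ 4))
    (a : Plaq (F.P K) (j + 1)) (U U' : GaugeField (F.P K) 0 (Matrix.specialUnitaryGroup (Fin 2) ℂ))
    (hU : (∀ (i : ℕ) (q : Plaq (F.P K) i), i < j + 1 → Site.tdist (fun k => ((((q.src k).val * F.L ^ i : ℕ)) : ZMod ((F.P K).sitesPerDir 0))) (fun k => ((((a.src k).val * F.L ^ (j + 1) : ℕ)) : ZMod ((F.P K).sitesPerDir 0))) + 64 * F.L ^ i ≤ 64 * F.L ^ (j + 1) → GaugeGroup.dist1 (GaugeField.plaqHol (Averaging.iter (fun i' => BlockAveraging.blockAvg (P := F.P K) (j := i') T3UnitLawDensityEML.ℰp) i U) q) < T3UnitScaleTilt.θBal F.L γ b₀ p₀ (K - i)))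
    (hU' : (∀ (i : ℕ) (q : Plaq (F.P K) i), i < j + 1 → Site.tdist (fun k => ((((q.src k).val * F.L ^ i : ℕ)) : ZMod ((F.P K).sitesPerDir 0))) (fun k => ((((a.src k).val * F.L ^ (j + 1) : ℕ)) : ZMod ((F.P K).sitesPerDir 0))) + 64 * F.L ^ i ≤ 64 * F.L ^ (j + 1) → GaugeGroup.dist1 (GaugeField.plaqHol (Averaging.iter (fun i' => BlockAveraging.blockAvg (P := F.P K) (j := i') T3UnitLawDensityEML.ℰp) i U') q) < T3UnitScaleTilt.θBal F.L γ b₀ p₀ (K - i))) :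
    ∃ g : GaugeTransf (F.P K) 0 (Matrix.specialUnitaryGroup (Fin 2) ℂ), ∀ (i : ℕ), i ≤ j →
      ∀ (h : GaugeTransf (F.P K) i (Matrix.specialUnitaryGroup (Fin 2) ℂ)) (c : PBond (F.P K) i),
      Site.tdist (fun k => ((((c.src k).val * F.L ^ i : ℕ)) : ZMod ((F.P K).sitesPerDir 0)))
          (fun k => ((((a.src k).val * F.L ^ (j + 1) : ℕ)) : ZMod ((F.P K).sitesPerDir 0))) ≤ 5 * F.L ^ (j + 1) + 12 * (F.L ^ i - 1) →
      ‖pertVar (Averaging.iter (fun i'' => BlockAveraging.blockAvg (P := F.P K) (j := i'') T3UnitLawDensityEML.ℰp) i U)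
          (GaugeField.gaugeAct h (Averaging.iter (fun i'' => BlockAveraging.blockAvg (P := F.P K) (j := i'') T3UnitLawDensityEML.ℰp) i (GaugeField.gaugeAct g U'))) c‖ ≤
        2 * (72 * (F.L : ℝ) ^ 2 * (∑ i'' ∈ Finset.Ico i (j + 1), θBal F.L γ b₀ p₀ (K - i'') * ((2 : ℝ) / F.L) ^ (i'' - i)) +
          3347 * (F.L : ℝ) ^ 3 * θBal F.L γ b₀ p₀ (K - j) * ((2 : ℝ) / F.L) ^ (j + 1 - i)) +
          dist1 (h c.src) + dist1 (h c.tgt) := by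
  obtain ⟨g, hg⟩ := exists_relGauge_iter_dist1_le_of_windows_sharp hjK hγ hγ1 hb hp hθσ a U U' hU hU'
  refine ⟨g, fun i hi h c hc => ?_⟩
  have h1 := hg i hi c hc
  rw [norm_pertVar_eq_dist1]
  have h2 := dist1_gaugeAct_mul_inv_le (Averaging.iter (fun i'' => BlockAveraging.blockAvg (P := F.P K) (j := i'') T3UnitLawDensityEML.ℰp) i U)
    (Averaging.iter (fun i'' => BlockAveraging.blockAvg (P := F.P K) (j := i'') T3UnitLawDensityEML.ℰp) i (GaugeField.gaugeAct g U')) h c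
  linarith

/-- ★★ **THE SHARPER TRANSFER** (sharp twin of ✓`…PertVar.exists_relGauge_norm_pertVar_iter_gaugeAct_le_of_windows`): a further gauge change `φ` at
height `i` costs exactly its covariant derivative `‖pertVar (Ū^i U) ((Ū^i U)^φ) c‖`. [folklore] -/
theorem exists_relGauge_norm_pertVar_iter_gaugeAct_le_of_windows_sharp (hjK : j + 3 ≤ K) (hγ : 0 < γ) (hγ1 : γ ≤ 1) (hb : 0 < b₀) (hp : 0 ≤ p₀)
    (hθσ : ∀ i, i ≤ j → θBal F.L γ b₀ p₀ (K - i) ≤ 1 / (2 * 10 ^ 7 * (F.L : ℝ) ^ 4))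
    (a : Plaq (F.P K) (j + 1)) (U U' : GaugeField (F.P K) 0 (Matrix.specialUnitaryGroup (Fin 2) ℂ))
    (hU : (∀ (i : ℕ) (q : Plaq (F.P K) i), i < j + 1 → Site.tdist (fun k => ((((q.src k).val * F.L ^ i : ℕ)) : ZMod ((F.P K).sitesPerDir 0))) (fun k => ((((a.src k).val * F.L ^ (j + 1) : ℕ)) : ZMod ((F.P K).sitesPerDir 0))) + 64 * F.L ^ i ≤ 64 * F.L ^ (j + 1) → GaugeGroup.dist1 (GaugeField.plaqHol (Averaging.iter (fun i' => BlockAveraging.blockAvg (P := F.P K) (j := i') T3UnitLawDensityEML.ℰp) i U) q) < T3UnitScaleTilt.θBal F.L γ b₀ p₀ (K - i)))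
    (hU' : (∀ (i : ℕ) (q : Plaq (F.P K) i), i < j + 1 → Site.tdist (fun k => ((((q.src k).val * F.L ^ i : ℕ)) : ZMod ((F.P K).sitesPerDir 0))) (fun k => ((((a.src k).val * F.L ^ (j + 1) : ℕ)) : ZMod ((F.P K).sitesPerDir 0))) + 64 * F.L ^ i ≤ 64 * F.L ^ (j + 1) → GaugeGroup.dist1 (GaugeField.plaqHol (Averaging.iter (fun i' => BlockAveraging.blockAvg (P := F.P K) (j := i') T3UnitLawDensityEML.ℰp) i U') q) < T3UnitScaleTilt.θBal F.L γ b₀ p₀ (K - i))) :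
    ∃ g : GaugeTransf (F.P K) 0 (Matrix.specialUnitaryGroup (Fin 2) ℂ), ∀ (i : ℕ), i ≤ j →
      ∀ (φ : GaugeTransf (F.P K) i (Matrix.specialUnitaryGroup (Fin 2) ℂ)) (c : PBond (F.P K) i),
      Site.tdist (fun k => ((((c.src k).val * F.L ^ i : ℕ)) : ZMod ((F.P K).sitesPerDir 0)))
          (fun k => ((((a.src k).val * F.L ^ (j + 1) : ℕ)) : ZMod ((F.P K).sitesPerDir 0))) ≤ 5 * F.L ^ (j + 1) + 12 * (F.L ^ i - 1) →
      ‖pertVar (Averaging.iter (fun i'' => BlockAveraging.blockAvg (P := F.P K) (j := i'') T3UnitLawDensityEML.ℰp) i U)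
          (GaugeField.gaugeAct φ (Averaging.iter (fun i'' => BlockAveraging.blockAvg (P := F.P K) (j := i'') T3UnitLawDensityEML.ℰp) i (GaugeField.gaugeAct g U'))) c‖ ≤
        2 * (72 * (F.L : ℝ) ^ 2 * (∑ i'' ∈ Finset.Ico i (j + 1), θBal F.L γ b₀ p₀ (K - i'') * ((2 : ℝ) / F.L) ^ (i'' - i)) +
          3347 * (F.L : ℝ) ^ 3 * θBal F.L γ b₀ p₀ (K - j) * ((2 : ℝ) / F.L) ^ (j + 1 - i)) +
          ‖pertVar (Averaging.iter (fun i'' => BlockAveraging.blockAvg (P := F.P K) (j := i'') T3UnitLawDensityEML.ℰp) i U)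
            (GaugeField.gaugeAct φ (Averaging.iter (fun i'' => BlockAveraging.blockAvg (P := F.P K) (j := i'') T3UnitLawDensityEML.ℰp) i U)) c‖ := by
  obtain ⟨g, hg⟩ := exists_relGauge_iter_dist1_le_of_windows_sharp hjK hγ hγ1 hb hp hθσ a U U' hU hU'
  refine ⟨g, fun i hi φ c hc => ?_⟩
  have h1 := hg i hi c hc
  have h2 := dist1_gaugeAct_gaugeAct_mul_inv_le (Averaging.iter (fun i'' => BlockAveraging.blockAvg (P := F.P K) (j := i'') T3UnitLawDensityEML.ℰp) i U)
    (Averaging.iter (fun i'' => BlockAveraging.blockAvg (P := F.P K) (j := i'') T3UnitLawDensityEML.ℰp) i (GaugeField.gaugeAct g U'))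
    φ (fun _ => 1) c
  have e1 : GaugeField.gaugeAct (fun _ => (1 : Matrix.specialUnitaryGroup (Fin 2) ℂ))
      (Averaging.iter (fun i'' => BlockAveraging.blockAvg (P := F.P K) (j := i'') T3UnitLawDensityEML.ℰp) i (GaugeField.gaugeAct g U')) =
      (Averaging.iter (fun i'' => BlockAveraging.blockAvg (P := F.P K) (j := i'') T3UnitLawDensityEML.ℰp) i (GaugeField.gaugeAct g U')) := by
    funext b; simp [GaugeField.gaugeAct]
  rw [e1] at h2
  rw [norm_pertVar_eq_dist1, norm_pertVar_eq_dist1]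
  linarith

end Summit.QuantumFields.YangMills.Theorems.PoincareLipschitzHierAlignT3SharpSimult

end
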